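import Summits.ValiantsHypothesis.ValiantsHypothesis.Theorems.KPlusLogSqLawTropicalBAffineDualSector

/-!
# Route «KPlusLogSqLaw», crux `TropicalB` (stmt-ValiantsHypothesis-19771) — the AFFINE-DUAL SECTOR LAW, part 3:
# the CHAIN-INTERNAL form — a gauge that orders only NEIGHBOURING terms column-wise already gives `n + m ≤ K·m²`

HONEST FRAMING.  Helper (`--supports stmt-ValiantsHypothesis-19771`, def-free), continuation of `…TropicalBAffineDualSector` (part 1) and
`…TropicalBAffineDualPieces` (part 2), same seat.  A SECTOR theorem about dominant chains of ARBITRARY dominance designs; it bounds nothing for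
`TropicalB` in its window and asserts nothing about `TropicalB`, `Lifting` (stmt-ValiantsHypothesis-19772), `WeakLifting`
(stmt-ValiantsHypothesis-19561), `KPlusLogSqLaw`, `MatrixDescartes` (stmt-ValiantsHypothesis-18050) or `VP ≠ VNP`.

WHAT IS SHARPENED.  Part 1 asks the affine row gauge `(S, x, y)` to certify every chain term against EVERY present incidence of its column.
Its proof uses the certificate only between NEIGHBOURS: at `θₖ` against the incidences of `pₖ₊₁`, at `θₖ₊₁` against those of `pₖ`.  So the
law holds under the purely chain-internal hypothesis

  `LOCAL GAUGE`: for every step `k` and column `b`, writing `s = S·d (λ b) + x (σ b)` (gauged slope) and `c = S·v (σ b) b (λ b) + y (σ b)`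
  (gauged intercept) of the incidences of `pₖ` (`s₀, c₀`) and `pₖ₊₁` (`s₁, c₁`) in column `b`:
  `θₖ·s₁ − c₁ ≤ θₖ·s₀ − c₀` and `θₖ₊₁·s₀ − c₀ ≤ θₖ₊₁·s₁ − c₁`
  (each column, on its own, switches from its old to its new incidence between `θₖ` and `θₖ₊₁` under the gauge),

which mentions no incidence outside the chain (`chain_le_of_localGauge_card`: `n ≤ m·(#T − 1)`; `chain_le_of_localGauge`: `n ≤ m·(K·m − 1)`;
`localGauge_of_affineCert`: part 1's certificate implies the local gauge, so part 1 is the special case).  For a column whose ROW does not change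
at a step the two inequalities hold for the trivial gauge `x = y = 0` by dominance alone (`localGauge_of_sameRow`: switching one letter of a
unique optimum in place gives a present competitor); the content of a gauge is therefore exactly how it prices the columns whose row changes —
one pair `(xₐ, yₐ)` per ROW, shared by every step through that row.  Appendix (`localGauge_of_dualPotentials`, `chain_le_of_dualPotentials`,
`chain_le_of_dualPotentials_alt`): the same law stated on certificates in the tree's `isDominant_of_scaledPotential` format (row potentials
`uₖ a = θₖ·x a − y a` affine in the slope, column potentials `wₖ` arbitrary, tight on `pₖ`, weakly slack on present incidences).

READING (located, nothing asserted).  (1) Instrument use: whether an explicit chain (kit census output: terms and slopes) is affinely gauged is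
an LP feasibility question in the `2m + 1` unknowns `(x, y, S)` with `2·(#changed columns)` inequalities per step — no design data beyond the
chain's own incidences; by this file a feasible chain has `n ≤ K·m² − m`, and by part 2 a chain needing `P` gauges has `n + 1 ≤ P(Km² − m + 1)`.
(2) For the `K = 4` fork: a cubic `(m,4)` chain must defeat every single gauge on some step — concretely, for every `(x, y)` there is a step and
a row-changing column whose switch under `(x, y)` does not happen inside `[θₖ, θₖ₊₁]`.  [folklore: LP duality; elementary counting]
-/

set_option linter.dupNamespace false
set_option autoImplicit false

namespace Summit.ValiantsHypothesis.ValiantsHypothesis.Theorems.KPlusLogSqLaw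

open Summit.ValiantsHypothesis.ValiantsHypothesis.Theorems.MatrixDescartes.Negative
open Summit.ValiantsHypothesis.ValiantsHypothesis.Theorems.LacunarySymmetroidMatrixDescartes.TropicalCensus
  (present_of_termSign_ne_zero)
open scoped BigOperators
open Finset

namespace AffineDual

variable {m K : ℕ} (d : Fin K → ℕ) (v ε : Fin m → Fin m → Fin K → ℤ)

section Local

variable (S : ℤ) (x y : Fin m → ℤ) {n : ℕ} (θ : Fin (n + 1) → ℤ)
  (p : Fin (n + 1) → Equiv.Perm (Fin m) × (Fin m → Fin K))

/-- **part 1's certificate implies the local gauge** (the certificate at `θₖ` tested on `pₖ₊₁`'s incidence and at `θₖ₊₁` on `pₖ`'s; presence of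
chain incidences from dominance). -/
theorem localGauge_of_affineCert (hdom : ∀ k, IsDominant d v ε (θ k) (p k))
    (hcert : ∀ (k : Fin (n + 1)) (b a : Fin m) (l : Fin K), ε a b l ≠ 0 →
      S * (θ k * (d l : ℤ) - v a b l) + (θ k * x a - y a) ≤
        S * (θ k * (d ((p k).2 b) : ℤ) - v ((p k).1 b) b ((p k).2 b)) + (θ k * x ((p k).1 b) - y ((p k).1 b)))
    (k : Fin n) (b : Fin m) :
    (S * (θ k.castSucc * (d ((p k.succ).2 b) : ℤ) - v ((p k.succ).1 b) b ((p k.succ).2 b)) +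
        (θ k.castSucc * x ((p k.succ).1 b) - y ((p k.succ).1 b)) ≤
      S * (θ k.castSucc * (d ((p k.castSucc).2 b) : ℤ) - v ((p k.castSucc).1 b) b ((p k.castSucc).2 b)) +
        (θ k.castSucc * x ((p k.castSucc).1 b) - y ((p k.castSucc).1 b))) ∧
    (S * (θ k.succ * (d ((p k.castSucc).2 b) : ℤ) - v ((p k.castSucc).1 b) b ((p k.castSucc).2 b)) +
        (θ k.succ * x ((p k.castSucc).1 b) - y ((p k.castSucc).1 b)) ≤
      S * (θ k.succ * (d ((p k.succ).2 b) : ℤ) - v ((p k.succ).1 b) b ((p k.succ).2 b)) +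
        (θ k.succ * x ((p k.succ).1 b) - y ((p k.succ).1 b))) :=
  ⟨hcert k.castSucc b _ _ (present_of_termSign_ne_zero ε _ (hdom k.succ).1 b),
    hcert k.succ b _ _ (present_of_termSign_ne_zero ε _ (hdom k.castSucc).1 b)⟩

/-- **columns whose row does not change are locally gauged for free (trivial gauge)**: if `σₖ₊₁ b = σₖ b`, switching the letter of column `b`
in place turns the unique optimum `pₖ` into a present competitor (resp. `pₖ₊₁` into one), which gives both inequalities with `x = y = 0`,
`S = 1`. -/
theorem localGauge_of_sameRow (hdom : ∀ k, IsDominant d v ε (θ k) (p k)) (k : Fin n) (b : Fin m)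
    (hrow : (p k.succ).1 b = (p k.castSucc).1 b) :
    θ k.castSucc * (d ((p k.succ).2 b) : ℤ) - v ((p k.succ).1 b) b ((p k.succ).2 b) ≤
        θ k.castSucc * (d ((p k.castSucc).2 b) : ℤ) - v ((p k.castSucc).1 b) b ((p k.castSucc).2 b) ∧
      θ k.succ * (d ((p k.castSucc).2 b) : ℤ) - v ((p k.castSucc).1 b) b ((p k.castSucc).2 b) ≤
        θ k.succ * (d ((p k.succ).2 b) : ℤ) - v ((p k.succ).1 b) b ((p k.succ).2 b) := by
  classical
  -- generic step: switching the letter of column `b` of a dominant term `q` to a present letter `l` cannot raise the weight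
  have key : ∀ (θ₀ : ℤ) (q : Equiv.Perm (Fin m) × (Fin m → Fin K)), IsDominant d v ε θ₀ q → ∀ l : Fin K, ε (q.1 b) b l ≠ 0 →
      θ₀ * (d l : ℤ) - v (q.1 b) b l ≤ θ₀ * (d (q.2 b) : ℤ) - v (q.1 b) b (q.2 b) := by
    intro θ₀ q hq l hl
    by_cases hlb : l = q.2 b
    · rw [hlb]
    -- the competitor `q' = (q.1, update q.2 b l)`
    set q' : Equiv.Perm (Fin m) × (Fin m → Fin K) := (q.1, Function.update q.2 b l) with hq'
    have hne : q' ≠ q := by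
      intro h
      have := congrArg (fun r : Equiv.Perm (Fin m) × (Fin m → Fin K) => r.2 b) h
      simp [hq'] at this
      exact hlb this
    have hpres : termSign ε q' ≠ 0 := by
      unfold termSign
      refine mul_ne_zero (by simp [hq']) ?_
      rw [prod_ne_zero_iff]
      intro i _
      simp only [hq']
      by_cases hib : i = b
      · subst hib; simpa using hl
      · rw [Function.update_of_ne hib]; exact present_of_termSign_ne_zero ε _ hq.1 i
    have hlt := hq.2 q' hne hpres
    -- both weights as sums over columns; they differ only in column `b`
    unfold tropWeight at hlt
    have hs : ∑ i, (d (q'.2 i) : ℤ) = ∑ i, (d (q.2 i) : ℤ) - (d (q.2 b) : ℤ) + (d l : ℤ) := by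
      have h1 := Finset.sum_update_of_mem (mem_univ b) (fun i => (d (q.2 i) : ℤ)) (d l : ℤ)
      have h2 : (fun i => (d (q'.2 i) : ℤ)) = Function.update (fun i => (d (q.2 i) : ℤ)) b (d l : ℤ) := by
        funext i
        simp only [hq']
        by_cases hib : i = b
        · subst hib; simp
        · rw [Function.update_of_ne hib, Function.update_of_ne hib]
      rw [h2, h1, Finset.sdiff_singleton_eq_erase]
      have := Finset.add_sum_erase (univ : Finset (Fin m)) (fun i => (d (q.2 i) : ℤ)) (mem_univ b)
      linarith
    have hv : ∑ i, v (q'.1 i) i (q'.2 i) = ∑ i, v (q.1 i) i (q.2 i) - v (q.1 b) b (q.2 b) + v (q.1 b) b l := by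
      have h1 := Finset.sum_update_of_mem (mem_univ b) (fun i => v (q.1 i) i (q.2 i)) (v (q.1 b) b l)
      have h2 : (fun i => v (q'.1 i) i (q'.2 i)) = Function.update (fun i => v (q.1 i) i (q.2 i)) b (v (q.1 b) b l) := by
        funext i
        simp only [hq']
        by_cases hib : i = b
        · subst hib; simp
        · rw [Function.update_of_ne hib, Function.update_of_ne hib]
      rw [h2, h1, Finset.sdiff_singleton_eq_erase]
      have := Finset.add_sum_erase (univ : Finset (Fin m)) (fun i => v (q.1 i) i (q.2 i)) (mem_univ b)
      linarith
    rw [hs, hv] at hlt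
    linarith
  refine ⟨?_, ?_⟩
  · have h := key (θ k.castSucc) (p k.castSucc) (hdom k.castSucc) ((p k.succ).2 b)
      (by rw [← hrow]; exact present_of_termSign_ne_zero ε _ (hdom k.succ).1 b)
    rw [hrow]; exact h
  · have h := key (θ k.succ) (p k.succ) (hdom k.succ) ((p k.castSucc).2 b)
      (by rw [hrow]; exact present_of_termSign_ne_zero ε _ (hdom k.castSucc).1 b)
    rw [← hrow]; exact h

variable (hS : 0 < S) (hθ : StrictMono θ) (hdom : ∀ k, IsDominant d v ε (θ k) (p k))
  (hne : ∀ k : Fin n, p k.castSucc ≠ p k.succ)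
  (hloc : ∀ (k : Fin n) (b : Fin m),
    (S * (θ k.castSucc * (d ((p k.succ).2 b) : ℤ) - v ((p k.succ).1 b) b ((p k.succ).2 b)) +
        (θ k.castSucc * x ((p k.succ).1 b) - y ((p k.succ).1 b)) ≤
      S * (θ k.castSucc * (d ((p k.castSucc).2 b) : ℤ) - v ((p k.castSucc).1 b) b ((p k.castSucc).2 b)) +
        (θ k.castSucc * x ((p k.castSucc).1 b) - y ((p k.castSucc).1 b))) ∧
    (S * (θ k.succ * (d ((p k.castSucc).2 b) : ℤ) - v ((p k.castSucc).1 b) b ((p k.castSucc).2 b)) +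
        (θ k.succ * x ((p k.castSucc).1 b) - y ((p k.castSucc).1 b)) ≤
      S * (θ k.succ * (d ((p k.succ).2 b) : ℤ) - v ((p k.succ).1 b) b ((p k.succ).2 b)) +
        (θ k.succ * x ((p k.succ).1 b) - y ((p k.succ).1 b))))
include hS hθ hdom hne hloc

/-- under a local gauge not every column's gauged slope can stall at a step: some column rises strictly (the weight-tie argument of
part 1, which needs the gauge only between the two neighbours). -/
theorem not_forall_localGauge_le (k : Fin n) :
    ¬ ∀ b : Fin m, S * (d ((p k.succ).2 b) : ℤ) + x ((p k.succ).1 b) ≤ S * (d ((p k.castSucc).2 b) : ℤ) + x ((p k.castSucc).1 b) := by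
  intro hno
  have hlt : θ k.castSucc < θ k.succ := hθ Fin.castSucc_lt_succ
  have hcol : ∀ b : Fin m,
      S * (θ k.castSucc * (d ((p k.succ).2 b) : ℤ) - v ((p k.succ).1 b) b ((p k.succ).2 b)) +
          (θ k.castSucc * x ((p k.succ).1 b) - y ((p k.succ).1 b)) =
        S * (θ k.castSucc * (d ((p k.castSucc).2 b) : ℤ) - v ((p k.castSucc).1 b) b ((p k.castSucc).2 b)) +
          (θ k.castSucc * x ((p k.castSucc).1 b) - y ((p k.castSucc).1 b)) := by
    intro b
    obtain ⟨h₁, h₂⟩ := hloc k b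
    have hle := gaugedSlope_mono d v S x y θ p hθ k b h₁ h₂
    have heq : S * (d ((p k.castSucc).2 b) : ℤ) + x ((p k.castSucc).1 b) =
        S * (d ((p k.succ).2 b) : ℤ) + x ((p k.succ).1 b) := le_antisymm hle (hno b)
    have e₁ : S * v ((p k.castSucc).1 b) b ((p k.castSucc).2 b) + y ((p k.castSucc).1 b) ≤
        S * v ((p k.succ).1 b) b ((p k.succ).2 b) + y ((p k.succ).1 b) := by
      linear_combination h₁ + θ k.castSucc * heq
    have e₂ : S * v ((p k.succ).1 b) b ((p k.succ).2 b) + y ((p k.succ).1 b) ≤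
        S * v ((p k.castSucc).1 b) b ((p k.castSucc).2 b) + y ((p k.castSucc).1 b) := by
      linear_combination h₂ - θ k.succ * heq
    linear_combination (-θ k.castSucc) * heq + (le_antisymm e₁ e₂)
  have hsum := Finset.sum_congr rfl fun b (_ : b ∈ (univ : Finset (Fin m))) => hcol b
  rw [sum_gaugedScore d v S x y, sum_gaugedScore d v S x y] at hsum
  have hw : tropWeight d v (θ k.castSucc) (p k.succ) < tropWeight d v (θ k.castSucc) (p k.castSucc) :=
    (hdom k.castSucc).2 _ (hne k).symm (hdom k.succ).1
  have : S * tropWeight d v (θ k.castSucc) (p k.succ) < S * tropWeight d v (θ k.castSucc) (p k.castSucc) :=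
    mul_lt_mul_of_pos_left hw hS
  linarith

/-- **CHAIN-INTERNAL AFFINE-DUAL LAW (cardinality form): `n ≤ m·(#T − 1)`** under a local gauge, for every finite `T` containing the gauged
slopes `S·d l + x a`. [folklore] -/
theorem chain_le_of_localGauge_card (T : Finset ℤ) (hT : ∀ (a : Fin m) (l : Fin K), S * (d l : ℤ) + x a ∈ T) :
    n ≤ m * (T.card - 1) := by
  classical
  set f : Fin m → Fin (n + 1) → ℤ := fun b k => S * (d ((p k).2 b) : ℤ) + x ((p k).1 b) with hf
  have hmono : ∀ b, Monotone (f b) := fun b =>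
    Fin.monotone_iff_le_succ.mpr fun k => gaugedSlope_mono d v S x y θ p hθ k b (hloc k b).1 (hloc k b).2
  have hmem : ∀ b k, f b k ∈ T := fun b k => hT _ _
  set N : Fin m → ℕ := fun b => (univ.filter fun k : Fin n => f b k.castSucc < f b k.succ).card with hN
  have ha : n ≤ ∑ b, N b := by
    have h1 : ∑ b, N b = ∑ k : Fin n, ∑ b : Fin m, (if f b k.castSucc < f b k.succ then 1 else 0) := by
      rw [sum_comm]
      refine sum_congr rfl fun b _ => ?_
      rw [hN]
      exact card_filter _ _
    rw [h1]
    have h2 : ∀ k : Fin n, 1 ≤ ∑ b : Fin m, (if f b k.castSucc < f b k.succ then 1 else 0) := by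
      intro k
      obtain ⟨b, hb⟩ : ∃ b : Fin m,
          S * (d ((p k.castSucc).2 b) : ℤ) + x ((p k.castSucc).1 b) < S * (d ((p k.succ).2 b) : ℤ) + x ((p k.succ).1 b) := by
        by_contra h
        simp only [not_exists, not_lt] at h
        exact not_forall_localGauge_le d v ε S x y θ p hS hθ hdom hne hloc k h
      have hb' : f b k.castSucc < f b k.succ := hb
      calc (1 : ℕ) = (if f b k.castSucc < f b k.succ then 1 else 0) := by rw [if_pos hb']
        _ ≤ ∑ b : Fin m, (if f b k.castSucc < f b k.succ then 1 else 0) :=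
          single_le_sum (f := fun b' : Fin m => if f b' k.castSucc < f b' k.succ then 1 else 0)
            (fun _ _ => Nat.zero_le _) (mem_univ b)
    calc n = ∑ _k : Fin n, (1 : ℕ) := by simp
      _ ≤ _ := sum_le_sum fun k _ => h2 k
  have hb : ∀ b, N b + 1 ≤ T.card := by
    intro b
    have h0 : f b 0 ∈ T := hmem b 0
    have hcard : (T.erase (f b 0)).card = T.card - 1 := card_erase_of_mem h0
    have hpos : 1 ≤ T.card := card_pos.mpr ⟨_, h0⟩
    have hle : N b ≤ (T.erase (f b 0)).card := by
      rw [hN]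
      refine card_le_card_of_injOn (fun k : Fin n => f b k.succ) (fun k hk => ?_) (fun k hk k' hk' hkk' => ?_)
      · have hks : f b k.castSucc < f b k.succ := (mem_filter.mp (mem_coe.mp hk)).2
        have h0k : f b 0 ≤ f b k.castSucc := hmono b (Fin.zero_le _)
        have hne0 : f b k.succ ≠ f b 0 := by
          intro h
          rw [h] at hks
          exact absurd hks (not_lt.mpr h0k)
        exact mem_coe.mpr (mem_erase.mpr ⟨hne0, hmem b _⟩)
      · have e : f b k.succ = f b k'.succ := hkk'
        have hks : f b k.castSucc < f b k.succ := (mem_filter.mp (mem_coe.mp hk)).2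
        have hks' : f b k'.castSucc < f b k'.succ := (mem_filter.mp (mem_coe.mp hk')).2
        by_contra hne'
        rcases lt_or_gt_of_ne hne' with hlt | hlt
        · have hv : (k : ℕ) < (k' : ℕ) := Fin.lt_def.mp hlt
          have h1 : f b k.succ ≤ f b k'.castSucc := hmono b (by
            rw [Fin.le_iff_val_le_val]; simp only [Fin.val_succ, Fin.val_castSucc]; omega)
          exact absurd e (ne_of_lt (lt_of_le_of_lt h1 hks'))
        · have hv : (k' : ℕ) < (k : ℕ) := Fin.lt_def.mp hlt
          have h1 : f b k'.succ ≤ f b k.castSucc := hmono b (by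
            rw [Fin.le_iff_val_le_val]; simp only [Fin.val_succ, Fin.val_castSucc]; omega)
          exact absurd e.symm (ne_of_lt (lt_of_le_of_lt h1 hks))
    omega
  have hc : ∑ b : Fin m, N b ≤ ∑ _b : Fin m, (T.card - 1) := sum_le_sum fun b _ => by have := hb b; omega
  simp only [sum_const, card_univ, Fintype.card_fin, smul_eq_mul] at hc
  exact ha.trans hc

/-- **CHAIN-INTERNAL AFFINE-DUAL LAW: `n ≤ m·(K·m − 1)`** (`= K·m² − m`) — a dominant chain with distinct consecutive terms that is locally gauged by ONE
slope-affine row gauge (each column switches between its consecutive incidences inside `[θₖ, θₖ₊₁]` under the gauge) has at most `K·m² − m`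
steps, whatever the design and whatever the incidences off the chain. [folklore] -/
theorem chain_le_of_localGauge : n ≤ m * (K * m - 1) := by
  classical
  have h := chain_le_of_localGauge_card d v ε S x y θ p hS hθ hdom hne hloc
    ((univ : Finset (Fin m × Fin K)).image fun al => S * (d al.2 : ℤ) + x al.1)
    (fun a l => mem_image.mpr ⟨(a, l), mem_univ _, rfl⟩)
  have hcard : ((univ : Finset (Fin m × Fin K)).image fun al => S * (d al.2 : ℤ) + x al.1).card ≤ m * K :=
    card_image_le.trans (by simp)
  calc n ≤ m * (((univ : Finset (Fin m × Fin K)).image fun al => S * (d al.2 : ℤ) + x al.1).card - 1) := h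
    _ ≤ m * (m * K - 1) := Nat.mul_le_mul_left _ (Nat.sub_le_sub_right hcard 1)
    _ = m * (K * m - 1) := by rw [Nat.mul_comm m K]

end Local

/-! ### Appendix: the law in the tree's dual-certificate format (`isDominant_of_scaledPotential`-style potentials)

The tree certifies single dominant terms by potentials `u, w : Fin m → ℤ` tight on the term and bounding every present incidence
(`TropicalCensus.isDominant_of_scaledPotential`, scale `S`).  If along a chain the ROW potentials of such certificates are affine in the slope,
`uₖ a = θₖ·x a − y a` (the column potentials `wₖ` arbitrary), then the local gauge of this file holds with the gauge `(−x, −y)`, hence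
`n ≤ m(K m − 1)`.  This is the literal bridge from «the certificates we write» to the sector law. -/

section DualPotentials

variable {m K : ℕ} (d : Fin K → ℕ) (v ε : Fin m → Fin m → Fin K → ℤ)
  (S : ℤ) (x y : Fin m → ℤ) {n : ℕ} (θ : Fin (n + 1) → ℤ)
  (p : Fin (n + 1) → Equiv.Perm (Fin m) × (Fin m → Fin K)) (w : Fin (n + 1) → Fin m → ℤ)

/-- **affine row potentials in the tree's certificate format give the local gauge.**  Hypotheses, for every `k`: tightness on `pₖ`
(`θₖ·x (σₖ b) − y (σₖ b) + wₖ b = S(θₖ d (λₖ b) − v (σₖ b) b (λₖ b))`) and weak slack on every present incidence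
(`S(θₖ d l − v a b l) ≤ θₖ·x a − y a + wₖ b`). [folklore: LP duality] -/
theorem localGauge_of_dualPotentials (hdom : ∀ k, IsDominant d v ε (θ k) (p k))
    (htight : ∀ (k : Fin (n + 1)) (b : Fin m),
      θ k * x ((p k).1 b) - y ((p k).1 b) + w k b = S * (θ k * (d ((p k).2 b) : ℤ) - v ((p k).1 b) b ((p k).2 b)))
    (hslack : ∀ (k : Fin (n + 1)) (a b : Fin m) (l : Fin K), ε a b l ≠ 0 →
      S * (θ k * (d l : ℤ) - v a b l) ≤ θ k * x a - y a + w k b)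
    (k : Fin n) (b : Fin m) :
    (S * (θ k.castSucc * (d ((p k.succ).2 b) : ℤ) - v ((p k.succ).1 b) b ((p k.succ).2 b)) +
        (θ k.castSucc * (-x) ((p k.succ).1 b) - (-y) ((p k.succ).1 b)) ≤
      S * (θ k.castSucc * (d ((p k.castSucc).2 b) : ℤ) - v ((p k.castSucc).1 b) b ((p k.castSucc).2 b)) +
        (θ k.castSucc * (-x) ((p k.castSucc).1 b) - (-y) ((p k.castSucc).1 b))) ∧
    (S * (θ k.succ * (d ((p k.castSucc).2 b) : ℤ) - v ((p k.castSucc).1 b) b ((p k.castSucc).2 b)) +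
        (θ k.succ * (-x) ((p k.castSucc).1 b) - (-y) ((p k.castSucc).1 b)) ≤
      S * (θ k.succ * (d ((p k.succ).2 b) : ℤ) - v ((p k.succ).1 b) b ((p k.succ).2 b)) +
        (θ k.succ * (-x) ((p k.succ).1 b) - (-y) ((p k.succ).1 b))) := by
  have h₁ := hslack k.castSucc _ b _ (present_of_termSign_ne_zero ε _ (hdom k.succ).1 b)
  have t₁ := htight k.castSucc b
  have h₂ := hslack k.succ _ b _ (present_of_termSign_ne_zero ε _ (hdom k.castSucc).1 b)
  have t₂ := htight k.succ b
  simp only [Pi.neg_apply]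
  constructor
  · linarith
  · linarith

/-- **THE LAW IN CERTIFICATE FORMAT: `n ≤ m·(K·m − 1)`** for every chain of unique optima (strictly increasing slopes, distinct consecutive
terms) whose dual certificates have row potentials affine in the slope, `uₖ a = θₖ·x a − y a`, with arbitrary column potentials `wₖ`. -/
theorem chain_le_of_dualPotentials (hS : 0 < S) (hθ : StrictMono θ) (hdom : ∀ k, IsDominant d v ε (θ k) (p k))
    (hne : ∀ k : Fin n, p k.castSucc ≠ p k.succ)
    (htight : ∀ (k : Fin (n + 1)) (b : Fin m),
      θ k * x ((p k).1 b) - y ((p k).1 b) + w k b = S * (θ k * (d ((p k).2 b) : ℤ) - v ((p k).1 b) b ((p k).2 b)))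
    (hslack : ∀ (k : Fin (n + 1)) (a b : Fin m) (l : Fin K), ε a b l ≠ 0 →
      S * (θ k * (d l : ℤ) - v a b l) ≤ θ k * x a - y a + w k b) :
    n ≤ m * (K * m - 1) :=
  chain_le_of_localGauge d v ε S (-x) (-y) θ p hS hθ hdom hne
    (localGauge_of_dualPotentials d v ε S x y θ p w hdom htight hslack)

/-- sign-alternating form (the hypothesis list of `TropicalCensus.TropRootLawAt`) of `chain_le_of_dualPotentials`. -/
theorem chain_le_of_dualPotentials_alt (hS : 0 < S) (hθ : StrictMono θ) (hdom : ∀ k, IsDominant d v ε (θ k) (p k))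
    (halt : ∀ k : Fin n, termSign ε (p k.castSucc) * termSign ε (p k.succ) < 0)
    (htight : ∀ (k : Fin (n + 1)) (b : Fin m),
      θ k * x ((p k).1 b) - y ((p k).1 b) + w k b = S * (θ k * (d ((p k).2 b) : ℤ) - v ((p k).1 b) b ((p k).2 b)))
    (hslack : ∀ (k : Fin (n + 1)) (a b : Fin m) (l : Fin K), ε a b l ≠ 0 →
      S * (θ k * (d l : ℤ) - v a b l) ≤ θ k * x a - y a + w k b) :
    n ≤ m * (K * m - 1) :=
  chain_le_of_dualPotentials d v ε S x y θ p w hS hθ hdom (CyclePotential.ne_of_alt ε p halt) htight hslack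

end DualPotentials

end AffineDual

end Summit.ValiantsHypothesis.ValiantsHypothesis.Theorems.KPlusLogSqLaw
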